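import Summits.QuantumAdvantage.QuantumAdvantage.Theorems.MobiusLadderLiouvilleOrthogonalTC0FewMajSens
import Summits.QuantumAdvantage.QuantumAdvantage.Theorems.MobiusLadderLiouvilleOrthogonalTC0SpectralLevel
import Literature.Computability.Complexity.CircuitRestriction
import Literature.Computability.Complexity.CircuitInputMap
import HarnessLib

/-!
# Crux `MobiusLadder.LiouvilleOrthogonalTC0` (stmt-QuantumAdvantage-1393): `λ` is orthogonal to every
`AC⁰` circuit reading the binary digits AND `O(log n)` arbitrary halfspace tests of them

Line `Sketch`, skeleton v7 (lead `prover-line-stmt-QuantumAdvantage-1393-c4-0`). The few-majority rung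
(`liouville_orthogonal_fewMaj`, `…FewMaj.lean`) in the cleanest, gate-free language: a polynomial-size
constant-depth circuit `C` over `acBasis` on `n + k` inputs, fed with the `n` digits of `N` and the values
of `k ≤ c₀ log n` integer linear threshold tests `L_a(N) = [θ_a ≤ Σ_i w_{a,i} bit_i(N)]` of ANY weights, is
asymptotically orthogonal to `λ`, uniformly in `C`, `w`, `θ`. Green's `AC⁰` theorem is `k = 0`; the
`LtfCombinationPoly` rung is the case where `C` ignores the digits.

Proof (independent of the gate-surgery files; the parameter lemmas `FewMaj3.eventually_logM_le`,
`FewMaj3.log_pow_le` live here and are reused by `…FewMaj.lean`): the guessing argument of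
`…FewMajSens.lean` without any gate surgery — `F(x) = C(x, L(x))` and
`C_v(x) = C(x, v)` is an `acBasis` circuit on the `n` digits (an input RESTRICTION followed by a renaming of
the inputs: `Circuit.exists_restrict`, `Circuit.mapInputs`), so for every partition the block sensitivity of
`F` is `≤ Σ_a sens(L_a) + Σ_v sens(C_v) ≤ k·2ⁿ√m + 2^k·2ⁿ·Φ(d,s)` (`FewMaj.sens_guess_le`, `stub_sensLtf`,
`stub_blockInfluence`, `stub_acInfluence`), and then the parameter analysis: at the spectral level
`m = ⌊n^{1/R}⌋₊ + 1` (`R = ⌈3/c⌉₊`, `c` = Bourgain's exponent, `δ = 1/(2R) = c₀`), `2^k ≤ n^δ`,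
`logM(2s) ≤ 5(deg p + 2) log n` (`ACForm.logM_two_mul_le`), `(log n)^d ≤ (2(d+1)/δ)^d n^{δ/2}`
(`Real.log_natCast_le_rpow_div`), so the tail is `≤ M·n^{-δ/2} → 0` and the single-level spectral
criterion `liouville_orthogonal_of_tailWeight_level` applies.

* `FewLtfAC0.sens_le`, `FewLtfAC0.tailWeight_le` — the accounting;
* `liouville_orthogonal_ac0_fewLtf` — the statement (registered stub `stub_ac0FewLtf`).
-/

set_option linter.dupNamespace false -- D-0017: single-problem summit ⇒ `QuantumAdvantage.QuantumAdvantage` by design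

noncomputable section

namespace Summit.QuantumAdvantage.QuantumAdvantage.Theorems.LiouvilleOrthogonalTC0

open Filter Finset Topology
open Literature.Computability.Complexity
open Literature.Computability.Complexity.GateList
open Literature.Computability.Complexity.LowDegree (tailWeight)
open Literature.Probability.RandomGraphs.LowDegree (sgn)
open Literature.NumberTheory.Sieve

namespace FewMaj3

/-- Parameter arithmetic: `(logM (2 max(2, p n)))^d ≤ (5 (deg p + 2) log n)^d` eventually. -/
theorem eventually_logM_le (p : Polynomial ℕ) (d : ℕ) :
    ∀ᶠ n : ℕ in atTop, ((ACForm.logM (2 * max 2 (p.eval n)) : ℝ)) ^ d ≤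
      (5 * ((p.natDegree : ℝ) + 2) * Real.log n) ^ d := by
  filter_upwards [eventually_ge_atTop (p.eval 1 + 2)] with n hn
  have hn1 : 1 ≤ n := by omega
  have hn2 : (2 : ℝ) ≤ n := by exact_mod_cast (show 2 ≤ n by omega)
  set s : ℕ := max 2 (p.eval n) with hs
  have hs2 : 2 ≤ s := le_max_left _ _
  have h1 : (ACForm.logM (2 * s) : ℝ) ≤ 5 * Real.log s := ACForm.logM_two_mul_le hs2
  -- `s ≤ n^{deg p + 2}`
  have hpe : p.eval n ≤ p.eval 1 * n ^ p.natDegree := by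
    rw [Polynomial.eval_eq_sum_range, Polynomial.eval_eq_sum_range, Finset.sum_mul]
    refine Finset.sum_le_sum fun i hi => ?_
    rw [one_pow, mul_one]
    have hi' : i ≤ p.natDegree := by
      have := Finset.mem_range.1 hi; omega
    exact Nat.mul_le_mul_left _ (Nat.pow_le_pow_right hn1 hi')
  have hsn : s ≤ n ^ (p.natDegree + 2) := by
    have hpow1 : 1 ≤ n ^ p.natDegree := Nat.one_le_pow _ _ hn1
    have hA : p.eval n ≤ n ^ (p.natDegree + 2) := by
      calc p.eval n ≤ p.eval 1 * n ^ p.natDegree := hpe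
        _ ≤ n * n ^ p.natDegree := Nat.mul_le_mul_right _ (by omega)
        _ ≤ (n * n) * n ^ p.natDegree := Nat.mul_le_mul_right _ (Nat.le_mul_of_pos_left _ (by omega))
        _ = n ^ (p.natDegree + 2) := by ring
    have hB : 2 ≤ n ^ (p.natDegree + 2) := by
      calc 2 ≤ n := by omega
        _ ≤ n * (n * n ^ p.natDegree) := Nat.le_mul_of_pos_right _ (by positivity)
        _ = n ^ (p.natDegree + 2) := by ring
    exact max_le hB hA
  have hlogs : Real.log s ≤ ((p.natDegree : ℝ) + 2) * Real.log n := by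
    have hs0 : (0 : ℝ) < s := by exact_mod_cast (show 0 < s by omega)
    calc Real.log s ≤ Real.log ((n : ℝ) ^ (p.natDegree + 2)) :=
          Real.log_le_log hs0 (by exact_mod_cast hsn)
      _ = ((p.natDegree : ℝ) + 2) * Real.log n := by rw [Real.log_pow]; push_cast; ring
  have hlogn : 0 ≤ Real.log n := Real.log_nonneg (by linarith)
  have h0 : (0 : ℝ) ≤ (ACForm.logM (2 * s) : ℝ) := Nat.cast_nonneg _
  have h2 : (ACForm.logM (2 * s) : ℝ) ≤ 5 * ((p.natDegree : ℝ) + 2) * Real.log n := by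
    calc (ACForm.logM (2 * s) : ℝ) ≤ 5 * Real.log s := h1
      _ ≤ 5 * (((p.natDegree : ℝ) + 2) * Real.log n) := by gcongr
      _ = 5 * ((p.natDegree : ℝ) + 2) * Real.log n := by ring
  exact pow_le_pow_left₀ h0 h2 d

/-- Parameter arithmetic: powers of `log n` lose against any power of `n`:
`(log n)^d ≤ (2(d+1)/δ)^d · n^{δ/2}` for `n ≥ 1`, `δ > 0`. -/
theorem log_pow_le {δ : ℝ} (hδ : 0 < δ) (d : ℕ) {n : ℕ} (hn : 1 ≤ n) :
    Real.log n ^ d ≤ (2 * ((d : ℝ) + 1) / δ) ^ d * (n : ℝ) ^ (δ / 2) := by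
  have hn0 : (0 : ℝ) ≤ n := Nat.cast_nonneg n
  have hn1 : (1 : ℝ) ≤ n := by exact_mod_cast hn
  set η : ℝ := δ / (2 * ((d : ℝ) + 1)) with hη
  have hη0 : 0 < η := by positivity
  have hlog : Real.log n ≤ (n : ℝ) ^ η / η := Real.log_natCast_le_rpow_div n hη0
  have hlog0 : 0 ≤ Real.log n := Real.log_nonneg hn1
  have h1 : Real.log n ^ d ≤ ((n : ℝ) ^ η / η) ^ d := pow_le_pow_left₀ hlog0 hlog d
  have h2 : ((n : ℝ) ^ η / η) ^ d = (1 / η) ^ d * (n : ℝ) ^ (η * d) := by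
    rw [div_pow, Real.rpow_mul hn0, Real.rpow_natCast]; ring
  have h3 : (n : ℝ) ^ (η * d) ≤ (n : ℝ) ^ (δ / 2) := by
    refine Real.rpow_le_rpow_of_exponent_le hn1 ?_
    rw [hη]
    have hd0 : (0 : ℝ) ≤ d := Nat.cast_nonneg d
    rw [div_mul_eq_mul_div, div_le_div_iff₀ (by positivity) (by positivity)]
    nlinarith
  have h4 : (1 / η) = 2 * ((d : ℝ) + 1) / δ := by rw [hη]; field_simp
  calc Real.log n ^ d ≤ ((n : ℝ) ^ η / η) ^ d := h1
    _ = (1 / η) ^ d * (n : ℝ) ^ (η * d) := h2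
    _ ≤ (1 / η) ^ d * (n : ℝ) ^ (δ / 2) := mul_le_mul_of_nonneg_left h3 (by positivity)
    _ = (2 * ((d : ℝ) + 1) / δ) ^ d * (n : ℝ) ^ (δ / 2) := by rw [h4]

end FewMaj3

namespace FewLtfAC0

variable {n m k : ℕ}

/-- **Fixing the extra inputs of an `acBasis` circuit.** For `C` on the inputs `Fin n ⊕ Fin k` and
constants `v ∈ {0,1}^k`, the function `x ↦ C(x, v)` of the first `n` inputs is computed by a circuit over
`acBasis` on `Fin n` of `acDepth ≤ max (acDepth C) 1` and size `≤ max |C| 1` (restriction + renaming). -/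
theorem exists_fix (hn : 1 ≤ n) (C : Circuit (Fin n ⊕ Fin k)) (hC : C.IsOver acBasis) (v : Fin k → Bool) :
    ∃ G : Circuit (Fin n), G.IsOver acBasis ∧ G.acDepth ≤ max C.acDepth 1 ∧ G.size ≤ max C.size 1 ∧
      ∀ x : Fin n → Bool, G.eval x = C.eval (Sum.elim x v) := by
  obtain ⟨C', hB', hs', hd', hev'⟩ :=
    C.exists_restrict hC (Sum.elim (fun _ : Fin n => (none : Option Bool)) (fun a : Fin k => some (v a)))
  set e : Fin n ⊕ Fin k → Fin n := Sum.elim id (fun _ => ⟨0, by omega⟩) with he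
  refine ⟨C'.mapInputs e, hB'.mapInputs e, ?_, ?_, fun x => ?_⟩
  · rw [Circuit.acDepth_mapInputs]; exact hd'
  · rw [Circuit.size_mapInputs]; exact hs'
  · rw [Circuit.eval_mapInputs, hev']
    congr 1
    funext i
    cases i with
    | inl i => simp [restrictInput, he]
    | inr a => simp [restrictInput]

/-- **Block sensitivity of `x ↦ C(x, L(x))`** (`C` over `acBasis` on `n + k` inputs of `acDepth ≤ d`,
`size ≤ s`, `d, s, n ≥ 1`; `L_1,…,L_k` integer threshold tests) along any partition into `m` blocks:
`≤ k·2ⁿ√m + 2^k·2ⁿ·Φ(d,s)`. -/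
theorem sens_le (hn : 1 ≤ n) (C : Circuit (Fin n ⊕ Fin k)) (hC : C.IsOver acBasis) {d s : ℕ}
    (hd : C.acDepth ≤ d) (hs : C.size ≤ s) (hd1 : 1 ≤ d) (h1 : 1 ≤ s)
    (w : Fin k → Fin n → ℤ) (θ : Fin k → ℤ) (π : Fin n → Fin m) :
    ∑ x : Fin n → Bool, ((univ.filter fun j : Fin m =>
        C.eval (Sum.elim x (fun a => decide (θ a ≤ ∑ i, w a i * (if x i then (1 : ℤ) else 0)))) ≠
          C.eval (Sum.elim (fun i => xor (x i) (decide (π i = j)))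
            (fun a => decide (θ a ≤ ∑ i, w a i *
              (if xor (x i) (decide (π i = j)) then (1 : ℤ) else 0))))).card : ℝ)
      ≤ (k : ℝ) * (2 ^ n * Real.sqrt m) +
        2 ^ k * (2 ^ n * ((ACForm.cA : ℝ) ^ (d + 2) * (ACForm.cB : ℝ) ^ (d + 2) *
          (ACForm.logM (2 * s) : ℝ) ^ d / Real.log 2)) := by
  set Φ : ℝ := (ACForm.cA : ℝ) ^ (d + 2) * (ACForm.cB : ℝ) ^ (d + 2) *
    (ACForm.logM (2 * s) : ℝ) ^ d / Real.log 2 with hΦ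
  set L : Fin k → (Fin n → Bool) → Bool :=
    fun a x => decide (θ a ≤ ∑ i, w a i * (if x i then (1 : ℤ) else 0)) with hL
  choose G hG using fun v : Fin k → Bool => exists_fix hn C hC v
  have hF : ∀ x : Fin n → Bool,
      C.eval (Sum.elim x (fun a => L a x)) = (G (fun a => L a x)).eval x :=
    fun x => ((hG _).2.2.2 x).symm
  have hacc := FewMaj.sens_guess_le (fun x => C.eval (Sum.elim x (fun a => L a x))) L
    (fun v x => (G v).eval x) hF π
  refine hacc.trans (add_le_add ?_ ?_)
  · calc ∑ a : Fin k, ∑ x : Fin n → Bool, ((univ.filter fun j : Fin m =>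
            L a x ≠ L a (fun i => xor (x i) (decide (π i = j)))).card : ℝ)
        ≤ ∑ _a : Fin k, 2 ^ n * Real.sqrt m :=
          Finset.sum_le_sum fun a _ => by simp only [hL]; exact stub_sensLtf (w a) (θ a) π
      _ = (k : ℝ) * (2 ^ n * Real.sqrt m) := by
          rw [Finset.sum_const, Finset.card_univ, Fintype.card_fin, nsmul_eq_mul]
  · calc ∑ v : Fin k → Bool, ∑ x : Fin n → Bool, ((univ.filter fun j : Fin m =>
            (G v).eval x ≠ (G v).eval (fun i => xor (x i) (decide (π i = j)))).card : ℝ)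
        ≤ ∑ _v : Fin k → Bool, 2 ^ n * Φ := by
          refine Finset.sum_le_sum fun v _ => ?_
          obtain ⟨hB', hd', hs', -⟩ := hG v
          exact (stub_blockInfluence (fun x => (G v).eval x) π).trans
            (stub_acInfluence (G v) hB' (hd'.trans (max_le hd hd1)) (hs'.trans (max_le hs h1)) h1)
      _ = 2 ^ k * (2 ^ n * Φ) := by
          rw [Finset.sum_const, Finset.card_univ, Fintype.card_fun, Fintype.card_bool, Fintype.card_fin,
            nsmul_eq_mul, Nat.cast_pow, Nat.cast_ofNat]

/-- **Fourier tail of `x ↦ C(x, L(x))`**: `≤ 3(k + 2^kΦ(d,s)/√m)/√m` for `m ≥ 10`. -/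
theorem tailWeight_le (hm : 10 ≤ m) (hn : 1 ≤ n) (C : Circuit (Fin n ⊕ Fin k)) (hC : C.IsOver acBasis)
    {d s : ℕ} (hd : C.acDepth ≤ d) (hs : C.size ≤ s) (hd1 : 1 ≤ d) (h1 : 1 ≤ s)
    (w : Fin k → Fin n → ℤ) (θ : Fin k → ℤ) :
    tailWeight (fun x : Fin n → Bool =>
        sgn (C.eval (Sum.elim x (fun a => decide (θ a ≤ ∑ i, w a i * (if x i then (1 : ℤ) else 0)))))) m
      ≤ 3 * ((k : ℝ) + 2 ^ k * ((ACForm.cA : ℝ) ^ (d + 2) * (ACForm.cB : ℝ) ^ (d + 2) *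
          (ACForm.logM (2 * s) : ℝ) ^ d / Real.log 2) / Real.sqrt m) / Real.sqrt m := by
  have hmpos : (0 : ℝ) < m := Nat.cast_pos.2 (by omega)
  have hs0 : 0 < Real.sqrt m := Real.sqrt_pos.2 hmpos
  refine stub_tailOfSens hm (fun x : Fin n → Bool =>
    C.eval (Sum.elim x (fun a => decide (θ a ≤ ∑ i, w a i * (if x i then (1 : ℤ) else 0))))) (fun π => ?_)
  have h := sens_le hn C hC hd hs hd1 h1 w θ π
  refine h.trans (le_of_eq ?_)
  field_simp

end FewLtfAC0

open FewLtfAC0 FewMaj3 in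
/-- **`λ` is orthogonal to every `AC⁰` circuit reading the binary digits and `O(log n)` arbitrary
halfspace tests of them** (unconditional). There is `c₀ > 0` such that for every depth `d`, size
polynomial `p` and `ε > 0`, eventually in `n`: for all `k ≤ c₀ log n`, every circuit `C` over `acBasis` on
`n + k` inputs with `acDepth ≤ d` and `size ≤ p(n)`, and all integer tests
`L_a(N) = [θ_a ≤ Σ_i w_{a,i} bit_i(N)]`,
`|Σ_{N<2ⁿ} λ(N) · sgn C(bits N, L_1(N), …, L_k(N))| ≤ ε · 2ⁿ`. -/
theorem liouville_orthogonal_ac0_fewLtf : ∃ c₀ : ℝ, 0 < c₀ ∧ ∀ (d : ℕ) (p : Polynomial ℕ) (ε : ℝ), 0 < ε →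
    ∀ᶠ n : ℕ in atTop, ∀ k : ℕ, (k : ℝ) ≤ c₀ * Real.log n →
      ∀ C : Circuit (Fin n ⊕ Fin k), C.IsOver acBasis → C.acDepth ≤ d → C.size ≤ p.eval n →
        ∀ (w : Fin k → Fin n → ℤ) (θ : Fin k → ℤ),
          |∑ N ∈ Finset.range (2 ^ n), ((ArithmeticFunction.liouville N : ℤ) : ℝ) *
              sgn (C.eval (Sum.elim (fun i : Fin n => Nat.testBit N i)
                (fun a => decide (θ a ≤ ∑ i, w a i * (if Nat.testBit N i then (1 : ℤ) else 0)))))|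
            ≤ ε * (2 : ℝ) ^ n := by
  obtain ⟨c, hc, hB⟩ := bourgain_liouville_walsh_holds
  set R : ℕ := ⌈(3 : ℝ) / c⌉₊ with hRdef
  have hR1 : 1 ≤ R := by
    have : (0 : ℝ) < 3 / c := by positivity
    exact Nat.one_le_iff_ne_zero.mpr (Nat.pos_iff_ne_zero.mp (Nat.ceil_pos.mpr this))
  have hRc : 3 ≤ (R : ℝ) * c := by
    have h1 : (3 : ℝ) / c ≤ R := Nat.le_ceil _
    have := mul_le_mul_of_nonneg_right h1 hc.le
    rwa [div_mul_cancel₀ _ hc.ne'] at this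
  have hRpos : (0 : ℝ) < R := by exact_mod_cast (show 0 < R by omega)
  set δ : ℝ := 1 / (2 * R) with hδdef
  have hδ : 0 < δ := by positivity
  have h2δ : 2 * δ = 1 / R := by rw [hδdef]; field_simp
  refine ⟨δ, hδ, fun d₀ p ε hε => ?_⟩
  -- w.l.o.g. `d ≥ 1`
  set d : ℕ := max d₀ 1 with hddef
  have hd1 : 1 ≤ d := le_max_right _ _
  have hε3 : 0 < (ε / 3) ^ 2 := by positivity
  set D : ℝ := 5 * ((p.natDegree : ℝ) + 2) with hDdef
  set KK : ℝ := (ACForm.cA : ℝ) ^ (d + 2) * (ACForm.cB : ℝ) ^ (d + 2) * D ^ d / Real.log 2 with hKKdef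
  have hl2 : 0 < Real.log 2 := Real.log_pos (by norm_num)
  have hKK0 : 0 ≤ KK := by rw [hKKdef, hDdef]; positivity
  set M : ℝ := 6 + 3 * KK * (2 * ((d : ℝ) + 1) / δ) ^ d with hMdef
  have hdec : Tendsto (fun n : ℕ => M * (n : ℝ) ^ (-(δ / 2))) atTop (𝓝 0) := by
    have h1 : Tendsto (fun n : ℕ => (n : ℝ) ^ (-(δ / 2))) atTop (𝓝 0) :=
      (tendsto_rpow_neg_atTop (by positivity)).comp tendsto_natCast_atTop_atTop
    simpa using h1.const_mul M
  have hlev9 : ∀ᶠ n : ℕ in atTop, 9 ≤ ⌊((n : ℝ)) ^ ((1 : ℝ) / R)⌋₊ :=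
    (LtfCore.tendsto_floor_rpow hR1).eventually (eventually_ge_atTop 9)
  filter_upwards [liouville_orthogonal_of_tailWeight_level hc hB hR1 hRc ε hε,
    hdec.eventually_le_const hε3, hlev9, eventually_ge_atTop 2, eventually_logM_le p d]
    with n hn hsmall h9 hn2 hlogM k hcount C hCB hd₀ hs w θ
  have hd : C.acDepth ≤ d := hd₀.trans (le_max_left _ _)
  refine hn (fun y => C.eval (Sum.elim y (fun a => decide (θ a ≤ ∑ i, w a i * (if y i then (1 : ℤ) else 0))))) ?_
  set kk : ℕ := ⌊((n : ℝ)) ^ ((1 : ℝ) / R)⌋₊ with hkkdef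
  set s : ℕ := max 2 (p.eval n) with hsdef
  have hs1 : 1 ≤ s := le_trans (by norm_num) (le_max_left _ _)
  have hCs : C.size ≤ s := hs.trans (le_max_right _ _)
  have htail := tailWeight_le (m := kk + 1) (by omega) (by omega) C hCB hd hCs hd1 hs1 w θ
  refine htail.trans (le_trans ?_ hsmall)
  set Φ : ℝ := (ACForm.cA : ℝ) ^ (d + 2) * (ACForm.cB : ℝ) ^ (d + 2) *
    (ACForm.logM (2 * s) : ℝ) ^ d / Real.log 2 with hΦdef
  have hΦ0 : 0 ≤ Φ := by rw [hΦdef]; positivity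
  have hnpos : (0 : ℝ) < n := by exact_mod_cast (show 0 < n by omega)
  have hn1 : (1 : ℝ) ≤ n := by exact_mod_cast (show 1 ≤ n by omega)
  have hlogn : 0 ≤ Real.log n := Real.log_nonneg hn1
  have hlev : (n : ℝ) ^ (2 * δ) < (kk : ℝ) + 1 := by rw [h2δ]; exact Nat.lt_floor_add_one _
  have hsq : (n : ℝ) ^ δ ≤ Real.sqrt ((((kk + 1 : ℕ) : ℝ))) := by
    have h1 : Real.sqrt ((n : ℝ) ^ (2 * δ)) ≤ Real.sqrt ((kk : ℝ) + 1) := Real.sqrt_le_sqrt hlev.le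
    have h2 : Real.sqrt ((n : ℝ) ^ (2 * δ)) = (n : ℝ) ^ δ := by
      rw [Real.sqrt_eq_rpow, ← Real.rpow_mul hnpos.le]; congr 1; ring
    rw [h2] at h1; push_cast; exact h1
  have hm : (n : ℝ) ^ (2 * δ) ≤ ((((kk + 1 : ℕ) : ℝ))) := by push_cast; exact hlev.le
  have hnδ : (0 : ℝ) < (n : ℝ) ^ δ := Real.rpow_pos_of_pos hnpos _
  have hn2δ : (0 : ℝ) < (n : ℝ) ^ (2 * δ) := Real.rpow_pos_of_pos hnpos _
  have hs0 : (0 : ℝ) < Real.sqrt ((((kk + 1 : ℕ) : ℝ))) := lt_of_lt_of_le hnδ hsq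
  have hm0 : (0 : ℝ) < ((((kk + 1 : ℕ) : ℝ))) := lt_of_lt_of_le hn2δ hm
  have h2k : (2 : ℝ) ^ k ≤ (n : ℝ) ^ δ := by
    have hk : (k : ℝ) ≤ δ * Real.log n := hcount
    have hlog2 : Real.log 2 ≤ 1 := by
      have := Real.log_two_lt_d9; linarith
    calc (2 : ℝ) ^ k = Real.exp (k * Real.log 2) := by
          rw [← Real.rpow_natCast, Real.rpow_def_of_pos (by norm_num)]; ring_nf
      _ ≤ Real.exp (δ * Real.log n) := by
          refine Real.exp_le_exp.2 ?_
          calc (k : ℝ) * Real.log 2 ≤ k * 1 := mul_le_mul_of_nonneg_left hlog2 (Nat.cast_nonneg k)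
            _ = k := mul_one _
            _ ≤ δ * Real.log n := hk
      _ = (n : ℝ) ^ δ := by rw [Real.rpow_def_of_pos hnpos]; ring_nf
  have hΦle : Φ ≤ KK * (2 * ((d : ℝ) + 1) / δ) ^ d * (n : ℝ) ^ (δ / 2) := by
    have h1 : ((ACForm.logM (2 * s) : ℝ)) ^ d ≤ (D * Real.log n) ^ d := by
      rw [hDdef, hsdef]; exact hlogM
    have h2 : (D * Real.log n) ^ d = D ^ d * Real.log n ^ d := mul_pow _ _ _
    have h3 := log_pow_le hδ d (show 1 ≤ n by omega)
    have hD0 : 0 ≤ D := by rw [hDdef]; positivity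
    calc Φ = (ACForm.cA : ℝ) ^ (d + 2) * (ACForm.cB : ℝ) ^ (d + 2) / Real.log 2 *
          ((ACForm.logM (2 * s) : ℝ)) ^ d := by rw [hΦdef]; ring
      _ ≤ (ACForm.cA : ℝ) ^ (d + 2) * (ACForm.cB : ℝ) ^ (d + 2) / Real.log 2 *
          (D ^ d * ((2 * ((d : ℝ) + 1) / δ) ^ d * (n : ℝ) ^ (δ / 2))) := by
          refine mul_le_mul_of_nonneg_left ?_ (by positivity)
          calc ((ACForm.logM (2 * s) : ℝ)) ^ d ≤ (D * Real.log n) ^ d := h1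
            _ = D ^ d * Real.log n ^ d := h2
            _ ≤ D ^ d * ((2 * ((d : ℝ) + 1) / δ) ^ d * (n : ℝ) ^ (δ / 2)) :=
                mul_le_mul_of_nonneg_left h3 (by positivity)
      _ = KK * (2 * ((d : ℝ) + 1) / δ) ^ d * (n : ℝ) ^ (δ / 2) := by rw [hKKdef]; ring
  have hlogle : Real.log n ≤ (2 / δ) * (n : ℝ) ^ (δ / 2) := by
    have h := Real.log_natCast_le_rpow_div n (show 0 < δ / 2 by positivity)
    calc Real.log n ≤ (n : ℝ) ^ (δ / 2) / (δ / 2) := h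
      _ = (2 / δ) * (n : ℝ) ^ (δ / 2) := by field_simp
  have hk0 : (0 : ℝ) ≤ k := Nat.cast_nonneg k
  have e1 : (n : ℝ) ^ (δ / 2) / (n : ℝ) ^ δ = (n : ℝ) ^ (-(δ / 2)) := by
    rw [← Real.rpow_sub hnpos]; congr 1; ring
  have e2 : (n : ℝ) ^ δ * (n : ℝ) ^ (δ / 2) / (n : ℝ) ^ (2 * δ) = (n : ℝ) ^ (-(δ / 2)) := by
    rw [← Real.rpow_add hnpos, ← Real.rpow_sub hnpos]; congr 1; ring
  calc 3 * ((k : ℝ) + 2 ^ k * Φ / Real.sqrt ((((kk + 1 : ℕ) : ℝ)))) / Real.sqrt ((((kk + 1 : ℕ) : ℝ)))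
      = 3 * (k : ℝ) / Real.sqrt ((((kk + 1 : ℕ) : ℝ))) +
          3 * (2 ^ k * Φ) / (Real.sqrt ((((kk + 1 : ℕ) : ℝ))) * Real.sqrt ((((kk + 1 : ℕ) : ℝ)))) := by
        field_simp
    _ = 3 * (k : ℝ) / Real.sqrt ((((kk + 1 : ℕ) : ℝ))) + 3 * (2 ^ k * Φ) / ((((kk + 1 : ℕ) : ℝ))) := by
        rw [Real.mul_self_sqrt hm0.le]
    _ ≤ 3 * (k : ℝ) / (n : ℝ) ^ δ + 3 * (2 ^ k * Φ) / (n : ℝ) ^ (2 * δ) := by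
        gcongr
    _ ≤ 3 * (δ * Real.log n) / (n : ℝ) ^ δ + 3 * ((n : ℝ) ^ δ * (KK * (2 * ((d : ℝ) + 1) / δ) ^ d *
          (n : ℝ) ^ (δ / 2))) / (n : ℝ) ^ (2 * δ) := by
        gcongr
    _ ≤ 3 * (δ * ((2 / δ) * (n : ℝ) ^ (δ / 2))) / (n : ℝ) ^ δ + 3 * ((n : ℝ) ^ δ * (KK * (2 * ((d : ℝ) + 1) / δ) ^ d *
          (n : ℝ) ^ (δ / 2))) / (n : ℝ) ^ (2 * δ) := by
        gcongr
    _ = 6 * ((n : ℝ) ^ (δ / 2) / (n : ℝ) ^ δ) +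
          3 * KK * (2 * ((d : ℝ) + 1) / δ) ^ d * ((n : ℝ) ^ δ * (n : ℝ) ^ (δ / 2) / (n : ℝ) ^ (2 * δ)) := by
        field_simp
        ring
    _ = M * (n : ℝ) ^ (-(δ / 2)) := by rw [e1, e2, hMdef]; ring

/-- **Registered stub `stub_ac0FewLtf`** (line `Sketch`, v7, lead c4): verbatim `liouville_orthogonal_ac0_fewLtf`. -/
theorem stub_ac0FewLtf : ∃ c₀ : ℝ, 0 < c₀ ∧ ∀ (d : ℕ) (p : Polynomial ℕ) (ε : ℝ), 0 < ε → ∀ᶠ n : ℕ in atTop, ∀ k : ℕ, (k : ℝ) ≤ c₀ * Real.log n → ∀ C : Circuit (Fin n ⊕ Fin k), C.IsOver acBasis → C.acDepth ≤ d → C.size ≤ p.eval n → ∀ (w : Fin k → Fin n → ℤ) (θ : Fin k → ℤ), |∑ N ∈ Finset.range (2 ^ n), ((ArithmeticFunction.liouville N : ℤ) : ℝ) * sgn (C.eval (Sum.elim (fun i : Fin n => Nat.testBit N i) (fun a => decide (θ a ≤ ∑ i, w a i * (if Nat.testBit N i then (1 : ℤ) else 0)))))| ≤ ε * (2 : ℝ)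 ^ n :=
  liouville_orthogonal_ac0_fewLtf

end Summit.QuantumAdvantage.QuantumAdvantage.Theorems.LiouvilleOrthogonalTC0

end
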